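import Literature.AlgebraicGeometry.Frobenioids.MotivatingExamplesSubHoldsC
import HarnessLib

/-!
# Frobenioids I, Theorem 6.4 (ii): order-compatibility of `Pic_Φ(A₁) ⥲ Pic_Φ(A₂)` FROM «arises from an
# isomorphism of monoids», and uniformity of the degree FROM naturality — sub-DAG rows T64ii/L01 ⟹ L02, L04

Mochizuki, *The geometry of Frobenioids I: the general theory*, Kyushu J. Math. **62** (2008) 293–400, §6,
Theorem 6.4 (ii), kurims text p. 114 ("there exists an element `deg(Ψ^rlf) ∈ ℝ_{>0}` … such that the isomorphism
`Pic_Φ(A₁) ⥲ Pic_Φ(A₂)` induced by `Ψ^rlf` is compatible with `δ_{A₁}`, `δ_{A₂}` up to the factor `deg(Ψ^rlf)`") and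
its proof p. 115 l. 34 – p. 116 l. 3: "the isomorphism of groups `Pic_Φ(A₁) ⥲ Pic_Φ(A₂)` determined by `Ψ^rlf` … is
compatible with the 'order structure' induced on both sides [via `δ_{A₁}`, `δ_{A₂}`] by the 'order structure' of
`ℝ`. [Indeed, this compatibility follows from the fact that the isomorphism in question arises from an isomorphism
of monoids `Φ₁^rlf(A₁) ⥲ Φ₂^rlf(A₂)`.]" [cite: MochizukiFrdI2008, Thm. 6.4 (ii) p.115]

PROOF-ONLY (cell abc-iut, sub-DAG `plan/L1/SUBDAG-FrdI-Thm64.md` rows **T64ii/L01 ⟹ L02** and **T64ii/L04**,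
L1-lead R108 (4)(E); seat abc-iut-w4-d086; 0 `def`, no instance, no notation).  Over abc-iut-L1-t3's FROZEN schema
`ArithRealification R_i` / `Thm64ii` / `Thm64iiDeg` (`ArithmeticFrobenioids.lean`) and abc-iut-L1-t1's
`Thm64ii_L02_orderCompat` / `Thm64ii_of_orderCompat` (`MotivatingExamplesSub.lean`) — nothing re-typed — the two
printed REASONS are made kernel-explicit as generic theorems, so that at THE constructions (the realified arithmetic
Frobenioids, THE `Pic_Φ`, THE `δ_A`, THE `picMap` induced by `Ψ^rlf` via [FrdI] Cor. 4.10 / 4.11 (iii)) the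
remaining inputs are exactly: the positive cones ARE the classes of effective real divisors, the monoid isomorphism
carries effective to effective, and `δ`, `picMap` are natural along (chains of) morphisms between Frobenius-trivial
objects over the connected base:

* `Thm64ii_L02_orderCompat_of_cones` — if for every Frobenius-trivial `A` the map `picMap_A` carries the
  non-negative cone of `Pic_Φ(A₁)` (w.r.t. `δ_{A₁}`) INTO the non-negative cone of `Pic_Φ(A₂)`, then T64ii/L02 holds
  (`δ_{A₂} ∘ picMap_A ∘ δ_{A₁}⁻¹` is monotone);
* `Thm64ii_L02_orderCompat_of_monoidIso` — the literal printed form: the cones are the images of "class maps"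
  `cl_i : M_i → Pic_Φ(A_i)` of (additively written) commutative monoids, and `picMap_A ∘ cl₁ = cl₂ ∘ m_A` for a
  monoid isomorphism `m_A : M₁ ≃+ M₂` ("arises from an isomorphism of monoids `Φ₁^rlf(A₁) ⥲ Φ₂^rlf(A₂)`");
* `Thm64ii_L04_uniform_of_naturality` — T64ii/L04 (ONE constant for all Frobenius-trivial `A`): if any two
  Frobenius-trivial `A`, `B` are linked by isomorphisms `τ₁ : Pic_Φ(A) ≃ Pic_Φ(B)`, `τ₂ : Pic_Φ(ΨA) ≃ Pic_Φ(ΨB)`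
  commuting with the `δ`'s and with `picMap` (naturality along the connected base `D`), then the composites
  `δ_{A₂} ∘ picMap ∘ δ_{A₁}⁻¹` do not depend on `A`;
* `Thm64ii_of_cones_of_naturality` — hence `Thm64ii R₁ R₂ Ψ picMap` (composition with abc-iut-L6-t10's
  `Thm64ii_of_orderCompat_holds` p413840, which uses abc-iut-L1-t1's T64ii/L03 `Thm64ii_L03_monotoneAddAut_holds`).

Nothing here is specific to the abc programme or bears on [IUTchIII] Cor. 3.12; classical order/algebra.
-/

noncomputable section

namespace Literature.AlgebraicGeometry.Frobenioids

open CategoryTheory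

universe u v

variable {F₁ : Type} [Field F₁] {K₁ : Type} [Field K₁] [Algebra F₁ K₁]
variable {F₂ : Type} [Field F₂] {K₂ : Type} [Field K₂] [Algebra F₂ K₂]
variable {Rlf₁ : Type u} [Category.{v} Rlf₁] {Rlf₂ : Type u} [Category.{v} Rlf₂]
variable (R₁ : ArithRealification (F := F₁) (K := K₁) Rlf₁) (R₂ : ArithRealification (F := F₂) (K := K₂) Rlf₂)

/-! ### T64ii/L01 ⟹ L02: order-compatibility from the cones -/

/-- A group homomorphism `ℝ → ℝ`-shaped composite is MONOTONE as soon as it maps non-negatives to non-negatives: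
here `t ↦ δ₂(picMap(δ₁⁻¹ t))` for additive equivalences. [cite: MochizukiFrdI2008, Thm. 6.4 (ii) p.115] -/
theorem monotone_of_map_nonneg {P₁ P₂ : Type*} [AddCommGroup P₁] [AddCommGroup P₂] (δ₁ : P₁ ≃+ ℝ) (δ₂ : P₂ ≃+ ℝ)
    (φ : P₁ ≃+ P₂) (h : ∀ x : P₁, 0 ≤ δ₁ x → 0 ≤ δ₂ (φ x)) :
    Monotone fun t : ℝ => δ₂ (φ (δ₁.symm t)) := by
  intro s t hst
  have hx : 0 ≤ δ₁ (δ₁.symm t - δ₁.symm s) := by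
    rw [map_sub, δ₁.apply_symm_apply, δ₁.apply_symm_apply]
    exact sub_nonneg.mpr hst
  have := h _ hx
  rw [map_sub, map_sub] at this
  exact sub_nonneg.mp this

/-- **T64ii/L02 from the cones** ("compatible with the 'order structure' induced on both sides [via `δ_{A₁}`,
`δ_{A₂}`] by the 'order structure' of `ℝ`", p. 115 l. 36 – p. 116 l. 1): if, for every Frobenius-trivial `A` with
Frobenius-trivial image, `picMap_A` maps the non-negative cone of `(Pic_Φ(A), δ_{A})` into that of
`(Pic_Φ(Ψ A), δ_{Ψ A})`, then `Thm64ii_L02_orderCompat R₁ R₂ Ψ picMap`. [cite: MochizukiFrdI2008, Thm. 6.4 (ii) p.115] -/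
theorem Thm64ii_L02_orderCompat_of_cones (Ψ : Rlf₁ ≌ Rlf₂)
    (picMap : ∀ A : Rlf₁, R₁.Pic A ≃+ R₂.Pic (Ψ.functor.obj A))
    (hcone : ∀ (A : Rlf₁) (hA : R₁.ops.IsFrobeniusTrivial A)
      (hA' : R₂.ops.IsFrobeniusTrivial (Ψ.functor.obj A)) (x : R₁.Pic A),
      0 ≤ R₁.δ A hA x → 0 ≤ R₂.δ _ hA' (picMap A x)) :
    Thm64ii_L02_orderCompat R₁ R₂ Ψ picMap :=
  fun A hA hA' => monotone_of_map_nonneg (R₁.δ A hA) (R₂.δ _ hA') (picMap A) (hcone A hA hA')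

/-- **T64ii/L02 in the printed form "arises from an isomorphism of monoids `Φ₁^rlf(A₁) ⥲ Φ₂^rlf(A₂)`"**
(p. 116 l. 1–2): for every Frobenius-trivial `A` (with Frobenius-trivial image) there are additive commutative monoids
`M₁`, `M₂` (the effective real divisors `Φ_i^rlf(A_i)`), "class maps" `cl_i : M_i →+ Pic_Φ(A_i)` whose images ARE
the non-negative cones (effective classes have `δ ≥ 0`, and every class with `δ ≥ 0` is effective — `δ_A` being THE
degree), and an isomorphism of monoids `m : M₁ ≃+ M₂` with `picMap_A ∘ cl₁ = cl₂ ∘ m`; then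
`Thm64ii_L02_orderCompat R₁ R₂ Ψ picMap`. [cite: MochizukiFrdI2008, Thm. 6.4 (ii) p.116] -/
theorem Thm64ii_L02_orderCompat_of_monoidIso (Ψ : Rlf₁ ≌ Rlf₂)
    (picMap : ∀ A : Rlf₁, R₁.Pic A ≃+ R₂.Pic (Ψ.functor.obj A))
    (hmon : ∀ (A : Rlf₁) (hA : R₁.ops.IsFrobeniusTrivial A) (hA' : R₂.ops.IsFrobeniusTrivial (Ψ.functor.obj A)),
      ∃ (M₁ M₂ : Type u) (_ : AddCommMonoid M₁) (_ : AddCommMonoid M₂) (cl₁ : M₁ →+ R₁.Pic A)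
        (cl₂ : M₂ →+ R₂.Pic (Ψ.functor.obj A)) (m : M₁ ≃+ M₂),
        (∀ x : R₁.Pic A, 0 ≤ R₁.δ A hA x ↔ x ∈ Set.range cl₁) ∧
        (∀ y : R₂.Pic (Ψ.functor.obj A), 0 ≤ R₂.δ _ hA' y ↔ y ∈ Set.range cl₂) ∧
        ∀ a : M₁, picMap A (cl₁ a) = cl₂ (m a)) :
    Thm64ii_L02_orderCompat R₁ R₂ Ψ picMap := by
  refine Thm64ii_L02_orderCompat_of_cones R₁ R₂ Ψ picMap fun A hA hA' x hx => ?_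
  obtain ⟨M₁, M₂, _, _, cl₁, cl₂, m, h₁, h₂, hcomm⟩ := hmon A hA hA'
  obtain ⟨a, rfl⟩ := (h₁ x).mp hx
  exact (h₂ _).mpr ⟨m a, (hcomm a).symm⟩

/-! ### T64ii/L04: one degree for all Frobenius-trivial objects, from naturality -/

/-- **T64ii/L04 — uniformity from naturality** (p. 114 (ii) "there exists an element `deg(Ψ^rlf) ∈ ℝ_{>0}`": ONE
constant; in print the different Frobenius-trivial `A` over the connected base `D` are linked by morphisms along
which `Pic_Φ`, `δ` and the `Ψ^rlf`-induced maps are natural): if any two Frobenius-trivial `A`, `B` (with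
Frobenius-trivial images) admit isomorphisms `τ₁ : Pic_Φ(A) ≃ Pic_Φ(B)`, `τ₂ : Pic_Φ(Ψ A) ≃ Pic_Φ(Ψ B)` compatible
with the `δ`'s and intertwining `picMap`, then the composites `δ_{Ψ A} ∘ picMap_A ∘ δ_A⁻¹` do not depend on `A` — the
L04 premise of `Thm64ii_of_orderCompat`. [cite: MochizukiFrdI2008, Thm. 6.4 (ii) p.114] -/
theorem Thm64ii_L04_uniform_of_naturality (Ψ : Rlf₁ ≌ Rlf₂)
    (picMap : ∀ A : Rlf₁, R₁.Pic A ≃+ R₂.Pic (Ψ.functor.obj A))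
    (hnat : ∀ (A B : Rlf₁) (hA : R₁.ops.IsFrobeniusTrivial A) (hA' : R₂.ops.IsFrobeniusTrivial (Ψ.functor.obj A))
      (hB : R₁.ops.IsFrobeniusTrivial B) (hB' : R₂.ops.IsFrobeniusTrivial (Ψ.functor.obj B)),
      ∃ (τ₁ : R₁.Pic A ≃+ R₁.Pic B) (τ₂ : R₂.Pic (Ψ.functor.obj A) ≃+ R₂.Pic (Ψ.functor.obj B)),
        (∀ x, R₁.δ B hB (τ₁ x) = R₁.δ A hA x) ∧ (∀ y, R₂.δ _ hB' (τ₂ y) = R₂.δ _ hA' y) ∧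
        ∀ x, picMap B (τ₁ x) = τ₂ (picMap A x)) :
    ∀ (A B : Rlf₁) (hA : R₁.ops.IsFrobeniusTrivial A) (hA' : R₂.ops.IsFrobeniusTrivial (Ψ.functor.obj A))
      (hB : R₁.ops.IsFrobeniusTrivial B) (hB' : R₂.ops.IsFrobeniusTrivial (Ψ.functor.obj B)) (t : ℝ),
      R₂.δ _ hA' (picMap A ((R₁.δ A hA).symm t)) = R₂.δ _ hB' (picMap B ((R₁.δ B hB).symm t)) := by
  intro A B hA hA' hB hB' t
  obtain ⟨τ₁, τ₂, hδ₁, hδ₂, hpm⟩ := hnat A B hA hA' hB hB'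
  -- `δ_B⁻¹ t = τ₁ (δ_A⁻¹ t)` since `δ_B ∘ τ₁ = δ_A`
  have h1 : (R₁.δ B hB).symm t = τ₁ ((R₁.δ A hA).symm t) := by
    apply (R₁.δ B hB).injective
    rw [(R₁.δ B hB).apply_symm_apply, hδ₁, (R₁.δ A hA).apply_symm_apply]
  rw [h1, hpm, hδ₂]

/-- **Theorem 6.4 (ii) from the two printed reasons** — cones (T64ii/L01 ⟹ L02) and naturality (T64ii/L04): then
`Thm64ii R₁ R₂ Ψ picMap` ("assertion (ii) follows immediately", p. 116 l. 2–3), via abc-iut-L6-t10's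
`Thm64ii_of_orderCompat_holds` (which composes with T64ii/L03, abc-iut-L1-t1's `Thm64ii_L03_monotoneAddAut_holds`).
[cite: MochizukiFrdI2008, Thm. 6.4 (ii) p.116] -/
theorem Thm64ii_of_cones_of_naturality (Ψ : Rlf₁ ≌ Rlf₂)
    (picMap : ∀ A : Rlf₁, R₁.Pic A ≃+ R₂.Pic (Ψ.functor.obj A))
    (hcone : ∀ (A : Rlf₁) (hA : R₁.ops.IsFrobeniusTrivial A)
      (hA' : R₂.ops.IsFrobeniusTrivial (Ψ.functor.obj A)) (x : R₁.Pic A),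
      0 ≤ R₁.δ A hA x → 0 ≤ R₂.δ _ hA' (picMap A x))
    (hnat : ∀ (A B : Rlf₁) (hA : R₁.ops.IsFrobeniusTrivial A) (hA' : R₂.ops.IsFrobeniusTrivial (Ψ.functor.obj A))
      (hB : R₁.ops.IsFrobeniusTrivial B) (hB' : R₂.ops.IsFrobeniusTrivial (Ψ.functor.obj B)),
      ∃ (τ₁ : R₁.Pic A ≃+ R₁.Pic B) (τ₂ : R₂.Pic (Ψ.functor.obj A) ≃+ R₂.Pic (Ψ.functor.obj B)),
        (∀ x, R₁.δ B hB (τ₁ x) = R₁.δ A hA x) ∧ (∀ y, R₂.δ _ hB' (τ₂ y) = R₂.δ _ hA' y) ∧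
        ∀ x, picMap B (τ₁ x) = τ₂ (picMap A x)) :
    Thm64ii R₁ R₂ Ψ picMap :=
  Thm64ii_of_orderCompat_holds R₁ R₂ Ψ picMap (Thm64ii_L02_orderCompat_of_cones R₁ R₂ Ψ picMap hcone)
    (Thm64ii_L04_uniform_of_naturality R₁ R₂ Ψ picMap hnat)

/-- **Theorem 6.4 (ii) from the monoid isomorphisms and naturality** — the fully printed form: `picMap` arises
from isomorphisms of monoids carrying the effective cones onto each other (T64ii/L01) and is natural along the
base (T64ii/L04); then `Thm64ii R₁ R₂ Ψ picMap`. [cite: MochizukiFrdI2008, Thm. 6.4 (ii) p.116] -/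
theorem Thm64ii_of_monoidIso_of_naturality (Ψ : Rlf₁ ≌ Rlf₂)
    (picMap : ∀ A : Rlf₁, R₁.Pic A ≃+ R₂.Pic (Ψ.functor.obj A))
    (hmon : ∀ (A : Rlf₁) (hA : R₁.ops.IsFrobeniusTrivial A) (hA' : R₂.ops.IsFrobeniusTrivial (Ψ.functor.obj A)),
      ∃ (M₁ M₂ : Type u) (_ : AddCommMonoid M₁) (_ : AddCommMonoid M₂) (cl₁ : M₁ →+ R₁.Pic A)
        (cl₂ : M₂ →+ R₂.Pic (Ψ.functor.obj A)) (m : M₁ ≃+ M₂),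
        (∀ x : R₁.Pic A, 0 ≤ R₁.δ A hA x ↔ x ∈ Set.range cl₁) ∧
        (∀ y : R₂.Pic (Ψ.functor.obj A), 0 ≤ R₂.δ _ hA' y ↔ y ∈ Set.range cl₂) ∧
        ∀ a : M₁, picMap A (cl₁ a) = cl₂ (m a))
    (hnat : ∀ (A B : Rlf₁) (hA : R₁.ops.IsFrobeniusTrivial A) (hA' : R₂.ops.IsFrobeniusTrivial (Ψ.functor.obj A))
      (hB : R₁.ops.IsFrobeniusTrivial B) (hB' : R₂.ops.IsFrobeniusTrivial (Ψ.functor.obj B)),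
      ∃ (τ₁ : R₁.Pic A ≃+ R₁.Pic B) (τ₂ : R₂.Pic (Ψ.functor.obj A) ≃+ R₂.Pic (Ψ.functor.obj B)),
        (∀ x, R₁.δ B hB (τ₁ x) = R₁.δ A hA x) ∧ (∀ y, R₂.δ _ hB' (τ₂ y) = R₂.δ _ hA' y) ∧
        ∀ x, picMap B (τ₁ x) = τ₂ (picMap A x)) :
    Thm64ii R₁ R₂ Ψ picMap :=
  Thm64ii_of_orderCompat_holds R₁ R₂ Ψ picMap (Thm64ii_L02_orderCompat_of_monoidIso R₁ R₂ Ψ picMap hmon)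
    (Thm64ii_L04_uniform_of_naturality R₁ R₂ Ψ picMap hnat)

end Literature.AlgebraicGeometry.Frobenioids

end
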